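import Mathlib

/-!
# Crux `SignCone.ConeMagnification` (stmt-RiemannHypothesis-16303), line `Sketch` r8, stub `stub_fakeMertens`,
# part 2a: window integrals and the SANDWICH of the sharp harmonic sums between window sums

Generic real-variable bookkeeping for the proof of the registered stub `stub_fakeMertens` (Mertens' theorem
for a fake von Mangoldt weight from the fake PNT).  Throughout, `w : ℝ → ℝ` is a continuous nonnegative
window vanishing for `|u| ≥ 2a` (`a > 0`); in the application `w(u) = e^{-u/2} Re K(u)` for the
autocorrelation `K = φ ⋆ φ̃` of a node-nonnegative bump `φ` supported in `[-a, a]`, and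
`κ = ∫_{-2a}^{2a} w = Re K̂(0)`.

* `win_integral_eq_zero_of_le`, `win_integral_eq_zero_of_ge`, `win_integral_full`, `win_integral_le_full` —
  `∫_A^B w` vanishes when `[A, B]` misses `(-2a, 2a)`, equals `κ` when `[A, B] ⊇ [-2a, 2a]`, and always lies
  in `[0, κ]`;
* `win_sandwich` — for `c ≥ 0`, `y ≥ 6a` and `N > e^{y + 2a}`, the window sum
  `Φ_N(y) = Σ_{n < N} (c(n)/n) ∫_{2a − log n}^{y − log n} w` satisfies
  `κ H(y − 2a) ≤ Φ_N(y) − F + κ H(4a) ≤ κ H(y + 2a)`,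
  where `H(z) = Σ_{1 ≤ n ≤ e^z} c(n)/n` are the sharp harmonic sums and `F = Σ_{n ≤ e^{4a}} (c(n)/n) ∫_{2a−log n}^{2a} w`
  is a constant (independent of `y`, `N`).
-/

noncomputable section

-- `Summit.RiemannHypothesis.RiemannHypothesis.…` repeats a namespace component by design (D-0017 layout).
set_option linter.dupNamespace false

open scoped BigOperators Topology
open MeasureTheory Set Filter

namespace Summit.RiemannHypothesis.RiemannHypothesis.Theorems.SignConeConeMagnification

namespace FakeMertens

variable {w : ℝ → ℝ} {a : ℝ}

/-! ## Window integrals -/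

/-- `∫_A^B w = 0` if `B ≤ -2a` (`w` vanishes on `|u| ≥ 2a`, `a ≥ 0`). [folklore] -/
theorem win_integral_eq_zero_of_le (hw0 : ∀ u, 2 * a ≤ |u| → w u = 0) (ha : 0 ≤ a) {A B : ℝ}
    (hAB : A ≤ B) (hB : B ≤ -(2 * a)) : ∫ u in A..B, w u = 0 := by
  rw [intervalIntegral.integral_congr (g := fun _ => (0 : ℝ)) fun u hu => ?_]
  · simp
  · rw [uIcc_of_le hAB] at hu
    refine hw0 u ?_
    have : u ≤ -(2 * a) := hu.2.trans hB
    rw [abs_of_nonpos (by linarith)]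
    linarith

/-- `∫_A^B w = 0` if `2a ≤ A`. [folklore] -/
theorem win_integral_eq_zero_of_ge (hw0 : ∀ u, 2 * a ≤ |u| → w u = 0) (ha : 0 ≤ a) {A B : ℝ}
    (hAB : A ≤ B) (hA : 2 * a ≤ A) : ∫ u in A..B, w u = 0 := by
  rw [intervalIntegral.integral_congr (g := fun _ => (0 : ℝ)) fun u hu => ?_]
  · simp
  · rw [uIcc_of_le hAB] at hu
    refine hw0 u ?_
    have : 2 * a ≤ u := hA.trans hu.1
    rw [abs_of_nonneg (by linarith)]
    exact this

/-- `∫_A^B w = ∫_{-2a}^{2a} w` if `A ≤ -2a` and `2a ≤ B`. [folklore] -/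
theorem win_integral_full (hwc : Continuous w) (hw0 : ∀ u, 2 * a ≤ |u| → w u = 0) (ha : 0 ≤ a)
    {A B : ℝ} (hA : A ≤ -(2 * a)) (hB : 2 * a ≤ B) :
    ∫ u in A..B, w u = ∫ u in (-(2 * a))..(2 * a), w u := by
  have hi : ∀ p q : ℝ, IntervalIntegrable w volume p q := fun p q => hwc.intervalIntegrable p q
  rw [← intervalIntegral.integral_add_adjacent_intervals (hi A (-(2 * a))) (hi (-(2 * a)) B),
    ← intervalIntegral.integral_add_adjacent_intervals (hi (-(2 * a)) (2 * a)) (hi (2 * a) B),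
    win_integral_eq_zero_of_le hw0 ha hA le_rfl, win_integral_eq_zero_of_ge hw0 ha hB le_rfl]
  ring

/-- `0 ≤ ∫_A^B w` for `A ≤ B`. [folklore]

Deprecated duplicate (dedup-03061): this is Mathlib's `intervalIntegral.integral_nonneg_of_forall hAB hw`;
use that lemma directly. -/
@[deprecated intervalIntegral.integral_nonneg_of_forall (since := "2026-08-17")]
theorem win_integral_nonneg (hw : ∀ u, 0 ≤ w u) {A B : ℝ} (hAB : A ≤ B) : 0 ≤ ∫ u in A..B, w u :=
  intervalIntegral.integral_nonneg_of_forall hAB hw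

/-- `∫_A^B w ≤ ∫_{-2a}^{2a} w` for `A ≤ B`. [folklore] -/
theorem win_integral_le_full (hwc : Continuous w) (hw : ∀ u, 0 ≤ w u) (hw0 : ∀ u, 2 * a ≤ |u| → w u = 0)
    (ha : 0 ≤ a) {A B : ℝ} (hAB : A ≤ B) :
    ∫ u in A..B, w u ≤ ∫ u in (-(2 * a))..(2 * a), w u := by
  rw [← win_integral_full hwc hw0 ha (min_le_right A (-(2 * a))) (le_max_right B (2 * a))]
  exact intervalIntegral.integral_mono_interval (min_le_left _ _) hAB (le_max_left _ _)
    (Eventually.of_forall fun u => hw u) (hwc.intervalIntegrable _ _)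

/-! ## The window terms `I_n(y) = ∫_{2a − log n}^{y − log n} w` -/

/-- Past the node (`log n + 2a ≤ y`): `I_n(y) = J_n := ∫_{2a − log n}^{2a} w` (independent of `y`). [folklore] -/
theorem win_term_eq_J (hwc : Continuous w) (hw0 : ∀ u, 2 * a ≤ |u| → w u = 0) (ha : 0 ≤ a)
    {L y : ℝ} (h : L + 2 * a ≤ y) :
    ∫ u in (2 * a - L)..(y - L), w u = ∫ u in (2 * a - L)..(2 * a), w u := by
  have hi : ∀ p q : ℝ, IntervalIntegrable w volume p q := fun p q => hwc.intervalIntegrable p q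
  rw [← intervalIntegral.integral_add_adjacent_intervals (hi (2 * a - L) (2 * a)) (hi (2 * a) (y - L)),
    win_integral_eq_zero_of_ge hw0 ha (by linarith) le_rfl, add_zero]

/-- Deep nodes (`4a ≤ log n`): `J_n = κ`. [folklore] -/
theorem win_J_eq_full (hwc : Continuous w) (hw0 : ∀ u, 2 * a ≤ |u| → w u = 0) (ha : 0 ≤ a)
    {L : ℝ} (hL : 4 * a ≤ L) :
    ∫ u in (2 * a - L)..(2 * a), w u = ∫ u in (-(2 * a))..(2 * a), w u :=
  win_integral_full hwc hw0 ha (by linarith) le_rfl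

/-- Before the node (`y + 2a ≤ log n`, `2a ≤ y`): `I_n(y) = 0`. [folklore] -/
theorem win_term_eq_zero (hw0 : ∀ u, 2 * a ≤ |u| → w u = 0) (ha : 0 ≤ a) {L y : ℝ} (hy : 2 * a ≤ y)
    (h : y + 2 * a ≤ L) : ∫ u in (2 * a - L)..(y - L), w u = 0 :=
  win_integral_eq_zero_of_le hw0 ha (by linarith) (by linarith)

/-! ## Harmonic sums over `[1, ⌊e^z⌋]` -/

/-- `n ≤ ⌊e^z⌋` gives `log n ≤ z` (`n ≥ 1`). [folklore] -/
theorem log_le_of_le_floor_exp {n : ℕ} (hn : 1 ≤ n) {z : ℝ} (h : n ≤ ⌊Real.exp z⌋₊) : Real.log n ≤ z := by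
  have hpos : (0 : ℝ) < n := by exact_mod_cast hn
  have h' : (n : ℝ) ≤ Real.exp z := (Nat.cast_le.2 h).trans (Nat.floor_le (Real.exp_pos z).le)
  calc Real.log n ≤ Real.log (Real.exp z) := Real.log_le_log hpos h'
    _ = z := Real.log_exp z

/-- `⌊e^z⌋ < n` gives `z < log n`. [folklore] -/
theorem lt_log_of_floor_exp_lt {n : ℕ} {z : ℝ} (h : ⌊Real.exp z⌋₊ < n) : z < Real.log n := by
  have h' : Real.exp z < n := Nat.lt_of_floor_lt h
  have hpos : (0 : ℝ) < n := (Real.exp_pos z).trans h'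
  calc z = Real.log (Real.exp z) := (Real.log_exp z).symm
    _ < Real.log n := Real.log_lt_log (Real.exp_pos z) h'

/-! ## The sandwich -/

/-- **Sandwich of the sharp harmonic sums between window sums.**  Let `w` be a continuous nonnegative window
vanishing for `|u| ≥ 2a` (`0 < a`), `κ = ∫_{-2a}^{2a} w`, `c ≥ 0`, `H(z) = Σ_{1 ≤ n ≤ e^z} c(n)/n`.  For `y ≥ 6a`
and `N > e^{y+2a}`, the window sum `Φ_N(y) = Σ_{n < N} (c(n)/n) ∫_{2a − log n}^{y − log n} w` satisfies
`κ H(y − 2a) ≤ Φ_N(y) − F + κ H(4a) ≤ κ H(y + 2a)` with the constant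
`F = Σ_{1 ≤ n ≤ e^{4a}} (c(n)/n) ∫_{2a − log n}^{2a} w`: nodes with `log n ≤ y − 2a` carry the full window
(`= κ` once `log n > 4a`), nodes with `log n > y + 2a` carry nothing, and the nodes in between carry a weight in
`[0, κ]`. [folklore] -/
theorem win_sandwich (hwc : Continuous w) (hw : ∀ u, 0 ≤ w u) (hw0 : ∀ u, 2 * a ≤ |u| → w u = 0)
    (ha : 0 < a) (c : ℕ → ℝ) (hc : ∀ n, 0 ≤ c n) {y : ℝ} (hy : 6 * a ≤ y) {N : ℕ}
    (hN : Real.exp (y + 2 * a) < N) :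
    (∫ u in (-(2 * a))..(2 * a), w u) * (∑ n ∈ Finset.Icc 1 ⌊Real.exp (y - 2 * a)⌋₊, c n / n) ≤
        (∑ n ∈ Finset.range N, c n / n * ∫ u in (2 * a - Real.log n)..(y - Real.log n), w u) -
          (∑ n ∈ Finset.Icc 1 ⌊Real.exp (4 * a)⌋₊, c n / n * ∫ u in (2 * a - Real.log n)..(2 * a), w u) +
          (∫ u in (-(2 * a))..(2 * a), w u) * (∑ n ∈ Finset.Icc 1 ⌊Real.exp (4 * a)⌋₊, c n / n) ∧
      (∑ n ∈ Finset.range N, c n / n * ∫ u in (2 * a - Real.log n)..(y - Real.log n), w u) -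
          (∑ n ∈ Finset.Icc 1 ⌊Real.exp (4 * a)⌋₊, c n / n * ∫ u in (2 * a - Real.log n)..(2 * a), w u) +
          (∫ u in (-(2 * a))..(2 * a), w u) * (∑ n ∈ Finset.Icc 1 ⌊Real.exp (4 * a)⌋₊, c n / n) ≤
        (∫ u in (-(2 * a))..(2 * a), w u) * (∑ n ∈ Finset.Icc 1 ⌊Real.exp (y + 2 * a)⌋₊, c n / n) := by
  have ha0 : 0 ≤ a := ha.le
  set κ := ∫ u in (-(2 * a))..(2 * a), w u with hκ
  set X₀ := ⌊Real.exp (4 * a)⌋₊ with hX₀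
  set X₁ := ⌊Real.exp (y - 2 * a)⌋₊ with hX₁
  set X₂ := ⌊Real.exp (y + 2 * a)⌋₊ with hX₂
  set f : ℕ → ℝ := fun n => c n / n * ∫ u in (2 * a - Real.log n)..(y - Real.log n), w u with hf
  have hκ0 : 0 ≤ κ := intervalIntegral.integral_nonneg_of_forall (by linarith) hw
  have hy2 : 2 * a ≤ y := by linarith
  -- orderings of the cut points
  have hX01 : X₀ ≤ X₁ := Nat.floor_le_floor (Real.exp_le_exp.2 (by linarith))
  have hX12 : X₁ ≤ X₂ := Nat.floor_le_floor (Real.exp_le_exp.2 (by linarith))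
  have hX2N : X₂ < N := by
    have h : (X₂ : ℝ) < N := (Nat.floor_le (Real.exp_pos _).le).trans_lt hN
    exact_mod_cast h
  have hN1 : 1 ≤ N := by omega
  have hIcc : ∀ M : ℕ, Finset.Icc 1 M = Finset.Ioc 0 M := fun M => by
    ext n
    simp only [Finset.mem_Icc, Finset.mem_Ioc]
    omega
  -- the window sum as a sum over `(0, N-1]`
  have hf0 : f 0 = 0 := by simp [hf]
  have hsumIoc : ∑ n ∈ Finset.range N, f n = ∑ n ∈ Finset.Ioc 0 (N - 1), f n := by
    have h1 : Finset.range N = insert 0 (Finset.Ioc 0 (N - 1)) := by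
      ext n
      simp only [Finset.mem_range, Finset.mem_insert, Finset.mem_Ioc]
      omega
    rw [h1, Finset.sum_insert (by simp), hf0, zero_add]
  -- split `(0, N-1] = (0, X₁] ∪ (X₁, X₂] ∪ (X₂, N-1]`
  have hsplit : ∑ n ∈ Finset.Ioc 0 (N - 1), f n =
      (∑ n ∈ Finset.Ioc 0 X₁, f n) + (∑ n ∈ Finset.Ioc X₁ X₂, f n) + ∑ n ∈ Finset.Ioc X₂ (N - 1), f n := by
    rw [Finset.sum_Ioc_consecutive f (Nat.zero_le X₁) hX12,
      Finset.sum_Ioc_consecutive f (Nat.zero_le X₂) (by omega)]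
  -- third block vanishes
  have hthird : ∑ n ∈ Finset.Ioc X₂ (N - 1), f n = 0 := by
    refine Finset.sum_eq_zero fun n hn => ?_
    have hn1 : X₂ < n := (Finset.mem_Ioc.1 hn).1
    have hlog : y + 2 * a < Real.log n := lt_log_of_floor_exp_lt hn1
    simp only [hf]
    rw [win_term_eq_zero hw0 ha0 hy2 hlog.le, mul_zero]
  -- first block: `(0, X₁] = (0, X₀] ∪ (X₀, X₁]`, full windows
  have hfirst : ∑ n ∈ Finset.Ioc 0 X₁, f n =
      (∑ n ∈ Finset.Icc 1 X₀, c n / n * ∫ u in (2 * a - Real.log n)..(2 * a), w u) +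
        κ * ∑ n ∈ Finset.Ioc X₀ X₁, c n / n := by
    rw [← Finset.sum_Ioc_consecutive f (Nat.zero_le X₀) hX01, hIcc X₀, Finset.mul_sum]
    congr 1
    · refine Finset.sum_congr rfl fun n hn => ?_
      have hn1 : 1 ≤ n := (Finset.mem_Ioc.1 hn).1
      have hlog : Real.log n ≤ 4 * a := log_le_of_le_floor_exp hn1 (Finset.mem_Ioc.1 hn).2
      simp only [hf]
      rw [win_term_eq_J hwc hw0 ha0 (by linarith)]
    · refine Finset.sum_congr rfl fun n hn => ?_
      have hn0 : X₀ < n := (Finset.mem_Ioc.1 hn).1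
      have hn1 : 1 ≤ n := by omega
      have hlog1 : Real.log n ≤ y - 2 * a := log_le_of_le_floor_exp hn1 (Finset.mem_Ioc.1 hn).2
      have hlog0 : 4 * a < Real.log n := lt_log_of_floor_exp_lt hn0
      simp only [hf]
      rw [win_term_eq_J hwc hw0 ha0 (by linarith), win_J_eq_full hwc hw0 ha0 hlog0.le, mul_comm]
  -- middle block: weights in `[0, κ]`
  have hmid0 : 0 ≤ ∑ n ∈ Finset.Ioc X₁ X₂, f n :=
    Finset.sum_nonneg fun n _ => mul_nonneg (div_nonneg (hc n) (Nat.cast_nonneg _))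
      (intervalIntegral.integral_nonneg_of_forall (by linarith) hw)
  have hmid1 : ∑ n ∈ Finset.Ioc X₁ X₂, f n ≤ κ * ∑ n ∈ Finset.Ioc X₁ X₂, c n / n := by
    rw [Finset.mul_sum]
    refine Finset.sum_le_sum fun n _ => ?_
    rw [mul_comm κ]
    exact mul_le_mul_of_nonneg_left (win_integral_le_full hwc hw hw0 ha0 (by linarith))
      (div_nonneg (hc n) (Nat.cast_nonneg _))
  -- harmonic sums as `Ioc` sums
  have hH1 : ∑ n ∈ Finset.Icc 1 X₁, c n / n =
      (∑ n ∈ Finset.Icc 1 X₀, c n / n) + ∑ n ∈ Finset.Ioc X₀ X₁, c n / n := by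
    rw [hIcc X₁, hIcc X₀, Finset.sum_Ioc_consecutive _ (Nat.zero_le X₀) hX01]
  have hH2 : ∑ n ∈ Finset.Icc 1 X₂, c n / n =
      (∑ n ∈ Finset.Icc 1 X₁, c n / n) + ∑ n ∈ Finset.Ioc X₁ X₂, c n / n := by
    rw [hIcc X₂, hIcc X₁, Finset.sum_Ioc_consecutive _ (Nat.zero_le X₁) hX12]
  -- assemble
  have hmain : (∑ n ∈ Finset.range N, f n) -
      (∑ n ∈ Finset.Icc 1 X₀, c n / n * ∫ u in (2 * a - Real.log n)..(2 * a), w u) +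
        κ * (∑ n ∈ Finset.Icc 1 X₀, c n / n) =
      κ * (∑ n ∈ Finset.Icc 1 X₁, c n / n) + ∑ n ∈ Finset.Ioc X₁ X₂, f n := by
    rw [hsumIoc, hsplit, hthird, hfirst, hH1]
    ring
  refine ⟨?_, ?_⟩
  · rw [hmain]
    linarith
  · rw [hmain, hH2, mul_add]
    linarith

/-- **Anchor `fakeMertensSandwich`** (registered sub-goal; `win_sandwich` with explicit quantifiers): the sharp
harmonic sums of a nonnegative weight are sandwiched between the window sums of any continuous nonnegative window
of half-width `2a`. [folklore] -/
theorem fakeMertensSandwich : ∀ w : ℝ → ℝ, ∀ a : ℝ, Continuous w → (∀ u, 0 ≤ w u) →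
    (∀ u, 2 * a ≤ |u| → w u = 0) → 0 < a → ∀ c : ℕ → ℝ, (∀ n, 0 ≤ c n) → ∀ y : ℝ, 6 * a ≤ y → ∀ N : ℕ,
    Real.exp (y + 2 * a) < N →
    (∫ u in (-(2 * a))..(2 * a), w u) * (∑ n ∈ Finset.Icc 1 ⌊Real.exp (y - 2 * a)⌋₊, c n / n) ≤
        (∑ n ∈ Finset.range N, c n / n * ∫ u in (2 * a - Real.log n)..(y - Real.log n), w u) -
          (∑ n ∈ Finset.Icc 1 ⌊Real.exp (4 * a)⌋₊, c n / n * ∫ u in (2 * a - Real.log n)..(2 * a), w u) +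
          (∫ u in (-(2 * a))..(2 * a), w u) * (∑ n ∈ Finset.Icc 1 ⌊Real.exp (4 * a)⌋₊, c n / n) ∧
      (∑ n ∈ Finset.range N, c n / n * ∫ u in (2 * a - Real.log n)..(y - Real.log n), w u) -
          (∑ n ∈ Finset.Icc 1 ⌊Real.exp (4 * a)⌋₊, c n / n * ∫ u in (2 * a - Real.log n)..(2 * a), w u) +
          (∫ u in (-(2 * a))..(2 * a), w u) * (∑ n ∈ Finset.Icc 1 ⌊Real.exp (4 * a)⌋₊, c n / n) ≤
        (∫ u in (-(2 * a))..(2 * a), w u) * (∑ n ∈ Finset.Icc 1 ⌊Real.exp (y + 2 * a)⌋₊, c n / n) :=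
  fun _ _ hwc hw hw0 ha c hc _ hy _ hN => win_sandwich hwc hw hw0 ha c hc hy hN

end FakeMertens

end Summit.RiemannHypothesis.RiemannHypothesis.Theorems.SignConeConeMagnification

end
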